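import Mathlib
import HarnessLib
import Summits.Ventures.LatticeQCDFlow.Scaling.CharFunTruncatedBound
import Summits.Ventures.LatticeQCDFlow.Scaling.HeterogeneousRowCLT

/-!
# LatticeQCDFlow / Scaling — the LINDEBERG central limit theorem for rows of independent,
# non-identical, UNBOUNDED square-integrable blocks

HONEST FRAMING: exact (Metropolis-corrected) sampling algorithms for lattice gauge theory;
figures of merit are autocorrelation/cost numbers at stated couplings and volumes; no
continuum-physics claim.

Venture `LatticeQCDFlow` (cell pub-lqcd), topic `Scaling`; FANOUT row 3 (`s0-u1-a`, S0-B
implementation A, GEN-19).  NEW WORK of the cell (row 3's truncated bound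
`Scaling/CharFunTruncatedBound` and the product lemma of `Scaling/HeterogeneousRowCLT`); NO definition
is introduced; nothing is cited (Lindeberg 1922 / Feller NAMED ONLY; Mathlib has the i.i.d. CLT).

## The statement

Row 3's row CLTs (`Scaling/TriangularRowCLT`, `Scaling/HeterogeneousRowCLT`) assume BOUNDED block
statistics — right for compact gauge groups, wrong for non-compact fields (scalar `φ⁴` blocks, energy
differences of unbounded actions).  This file removes the bound: for independent blocks with laws
`ρ_{n,i}` and centred square-integrable statistics `h_{n,i}` (`i < n`) such that
`n⁻¹Σᵢ E h_{n,i}² → σ²` and LINDEBERG's condition `n⁻¹Σᵢ E[h_{n,i}²; |h_{n,i}| > ε√n] → 0` for every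
`ε > 0`, the normalised row sum `(Σᵢ h_{n,i}(Yᵢ))/√n ⇒ N(0, σ²)`
(**`lindebergPi_tendstoInDistribution`**), via the per-block estimate
`‖φ(u) − (1 − u²E h²/2)‖ ≤ |u|³M·E h² + (3/2)u²·E[h²; |h| > M]` at `M = δ√n` and Feller's bound
`max_i E h_{n,i}²/n ≤ δ² + Lindeberg sum`.

NOT CLAIMED: dependent blocks; the Feller converse; rates; the log-normal acceptance consequence for
unbounded blocks (the exponential moments of row 3's universality files need more than Lindeberg);
any value at the cell's `(β, L)`; nothing re-scored.
-/

noncomputable section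

namespace Summit.Ventures.LatticeQCDFlow.Theory2

open MeasureTheory ProbabilityTheory Filter Finset Real Set Complex
open scoped Topology NNReal

/-! ## §2 The Lindeberg central limit theorem for heterogeneous rows -/

section Lindeberg

variable {Y : Type*} {mY : MeasurableSpace Y} {ρ : (n : ℕ) → Fin n → Measure Y}
  [∀ n i, IsProbabilityMeasure (ρ n i)] {h : (n : ℕ) → Fin n → Y → ℝ}
  {Ω' : Type*} {mΩ' : MeasurableSpace Ω'} {P' : Measure Ω'}

set_option maxHeartbeats 400000 in
/-- **THE LINDEBERG CLT FOR ROWS OF INDEPENDENT, NON-IDENTICAL, SQUARE-INTEGRABLE BLOCKS.**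
Laws `ρ_{n,i}`, centred statistics `h_{n,i} ∈ L²(ρ_{n,i})` (`i < n`) with
`n⁻¹ Σᵢ E h_{n,i}² → σ²` and Lindeberg's condition `n⁻¹ Σᵢ E[h_{n,i}²; |h_{n,i}| > ε√n] → 0` for
every `ε > 0`: under `⊗ᵢ ρ_{n,i}`, `(Σᵢ h_{n,i}(Yᵢ))/√n ⇒ N(0, σ²)`. [ours] -/
theorem lindebergPi_tendstoInDistribution (hm : ∀ n i, Measurable (h n i))
    (h2 : ∀ n i, MemLp (h n i) 2 (ρ n i)) (h0 : ∀ n i, ∫ y, h n i y ∂ρ n i = 0) {σ2 : ℝ}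
    (hσ : Tendsto (fun n : ℕ => (∑ i, ∫ y, h n i y ^ 2 ∂ρ n i) / n) atTop (𝓝 σ2))
    (hL : ∀ ε : ℝ, 0 < ε → Tendsto (fun n : ℕ =>
      (∑ i, ∫ y in {y | ε * Real.sqrt n < |h n i y|}, h n i y ^ 2 ∂ρ n i) / n) atTop (𝓝 0))
    [IsProbabilityMeasure P'] {Z : Ω' → ℝ} (hZ : HasLaw Z (gaussianReal 0 σ2.toNNReal) P') :
    TendstoInDistribution (fun (n : ℕ) (y : Fin n → Y) => (Real.sqrt n)⁻¹ * ∑ i, h n i (y i)) atTop Z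
      (fun n => Measure.pi (ρ n)) P' where
  forall_aemeasurable n := (Finset.aemeasurable_fun_sum _ fun i _ =>
    ((hm n i).comp (measurable_pi_apply i)).aemeasurable).const_mul _
  aemeasurable_limit := hZ.aemeasurable
  tendsto := by
    -- notation: `a n i = E h_{n,i}²/n`, `s n = Σᵢ a n i`, `ℓ n δ i = E[h_{n,i}²; |h| > δ√n]/n`, `L n δ = Σᵢ ℓ`
    set a : (n : ℕ) → Fin n → ℝ := fun n i => (∫ y, h n i y ^ 2 ∂ρ n i) / n with ha
    set ℓ : (n : ℕ) → ℝ → Fin n → ℝ := fun n δ i =>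
      (∫ y in {y | δ * Real.sqrt n < |h n i y|}, h n i y ^ 2 ∂ρ n i) / n with hℓ
    have ha0 : ∀ n i, 0 ≤ a n i := fun n i =>
      div_nonneg (integral_nonneg fun y => sq_nonneg _) (Nat.cast_nonneg n)
    have hℓ0 : ∀ n δ i, 0 ≤ ℓ n δ i := fun n δ i =>
      div_nonneg (setIntegral_nonneg (measurableSet_lt measurable_const (hm n i).abs)
        fun y _ => sq_nonneg _) (Nat.cast_nonneg n)
    have hs_eq : ∀ n : ℕ, (∑ i, ∫ y, h n i y ^ 2 ∂ρ n i) / n = ∑ i, a n i := fun n => by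
      simp only [ha, Finset.sum_div]
    have hL_eq : ∀ (n : ℕ) (δ : ℝ), (∑ i, ∫ y in {y | δ * Real.sqrt n < |h n i y|}, h n i y ^ 2 ∂ρ n i) / n
        = ∑ i, ℓ n δ i := fun n δ => by simp only [hℓ, Finset.sum_div]
    have hσ' : Tendsto (fun n : ℕ => ∑ i, a n i) atTop (𝓝 σ2) := hσ.congr fun n => hs_eq n
    have hL' : ∀ δ : ℝ, 0 < δ → Tendsto (fun n : ℕ => ∑ i, ℓ n δ i) atTop (𝓝 0) := fun δ hδ =>
      (hL δ hδ).congr fun n => hL_eq n δ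
    have hσ0 : 0 ≤ σ2 := ge_of_tendsto' hσ' fun n => Finset.sum_nonneg fun i _ => ha0 n i
    -- Feller: `a n i ≤ δ² + ℓ n δ i`
    have hFeller : ∀ (n : ℕ) (δ : ℝ) (i : Fin n), 0 < n → a n i ≤ δ ^ 2 + ℓ n δ i := by
      intro n δ i hn
      have hn' : (0 : ℝ) < n := Nat.cast_pos.2 hn
      have h1 := integral_sq_le_sq_add_trunc (ρ n i) (hm n i) (h2 n i) (δ * Real.sqrt n)
      simp only [ha, hℓ]
      rw [div_le_iff₀ hn', add_mul, div_mul_cancel₀ _ hn'.ne']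
      calc ∫ y, h n i y ^ 2 ∂ρ n i ≤ (δ * Real.sqrt n) ^ 2
            + ∫ y in {y | δ * Real.sqrt n < |h n i y|}, h n i y ^ 2 ∂ρ n i := h1
        _ = δ ^ 2 * n + ∫ y in {y | δ * Real.sqrt n < |h n i y|}, h n i y ^ 2 ∂ρ n i := by
            rw [mul_pow, Real.sq_sqrt hn'.le]
    refine ProbabilityMeasure.tendsto_iff_tendsto_charFun.2 fun t => ?_
    simp only [ProbabilityMeasure.coe_mk, heteroPi_charFun_inv_sqrt_mul_sum (ρ _) (hm _), hZ.map_eq,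
      charFun_gaussianReal, Complex.ofReal_zero, mul_zero, zero_mul, zero_sub,
      Real.coe_toNNReal σ2 hσ0]
    set z : (n : ℕ) → Fin n → ℂ := fun n i => charFun ((ρ n i).map (h n i)) ((Real.sqrt n)⁻¹ * t) - 1
      with hz
    -- the key bound: `‖z n i + t² a n i/2‖ ≤ |t|³ δ a n i + (3/2) t² ℓ n δ i` (`n ≥ 1`, `δ ≥ 0`)
    have hKB : ∀ (n : ℕ) (δ : ℝ) (i : Fin n), 0 < n → 0 ≤ δ →
        ‖z n i - ((-(t ^ 2 * a n i / 2) : ℝ) : ℂ)‖ ≤ |t| ^ 3 * δ * a n i + 3 / 2 * t ^ 2 * ℓ n δ i := by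
      intro n δ i hn hδ
      have hn' : (0 : ℝ) < n := Nat.cast_pos.2 hn
      have hsn : 0 < Real.sqrt n := Real.sqrt_pos.2 hn'
      have hb := norm_charFun_map_sub_taylor_le_trunc (ρ n i) (hm n i) (h2 n i) (h0 n i)
        ((Real.sqrt n)⁻¹ * t) (M := δ * Real.sqrt n) (mul_nonneg hδ hsn.le)
      have hu2 : ((Real.sqrt n)⁻¹ * t) ^ 2 = t ^ 2 / n := by
        rw [mul_pow, inv_pow, Real.sq_sqrt hn'.le]; ring
      have hu3 : |(Real.sqrt n)⁻¹ * t| ^ 3 * (δ * Real.sqrt n) = |t| ^ 3 * δ / n := by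
        rw [abs_mul, abs_of_nonneg (inv_nonneg.2 hsn.le), mul_pow, inv_pow]
        have h3 : Real.sqrt n ^ 3 = (n : ℝ) * Real.sqrt n := by rw [pow_succ, Real.sq_sqrt hn'.le]
        rw [h3]; field_simp
      rw [hu3, hu2] at hb
      have e1 : ((1 - (t ^ 2 / n * (∫ y, h n i y ^ 2 ∂ρ n i) / 2 : ℝ)) : ℂ)
          = 1 + ((-(t ^ 2 * a n i / 2) : ℝ) : ℂ) := by
        simp only [ha]; push_cast; ring
      rw [e1, ← sub_sub] at hb
      simp only [hz]
      refine hb.trans (le_of_eq ?_)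
      simp only [ha, hℓ]
      field_simp
    -- master bounds
    set C2 : ℝ := |t| ^ 3 + 2 * t ^ 2 + 1 with hC2
    have hC2pos : 0 < C2 := by positivity
    have hM3 : ∀ (n : ℕ) (δ : ℝ), 0 < n → 0 ≤ δ →
        ‖∑ i, z n i - ((-(t ^ 2 / 2 * ∑ i, a n i) : ℝ) : ℂ)‖
          ≤ |t| ^ 3 * δ * ∑ i, a n i + 3 / 2 * t ^ 2 * ∑ i, ℓ n δ i := by
      intro n δ hn hδ
      have e : ((-(t ^ 2 / 2 * ∑ i, a n i) : ℝ) : ℂ) = ∑ i : Fin n, ((-(t ^ 2 * a n i / 2) : ℝ) : ℂ) := by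
        rw [← Complex.ofReal_sum]; congr 1
        rw [Finset.mul_sum, ← Finset.sum_neg_distrib]
        exact Finset.sum_congr rfl fun i _ => by ring
      rw [e, ← Finset.sum_sub_distrib]
      refine (norm_sum_le _ _).trans ?_
      calc ∑ i, ‖z n i - ((-(t ^ 2 * a n i / 2) : ℝ) : ℂ)‖
          ≤ ∑ i, (|t| ^ 3 * δ * a n i + 3 / 2 * t ^ 2 * ℓ n δ i) :=
            Finset.sum_le_sum fun i _ => hKB n δ i hn hδ
        _ = |t| ^ 3 * δ * ∑ i, a n i + 3 / 2 * t ^ 2 * ∑ i, ℓ n δ i := by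
            rw [Finset.sum_add_distrib, Finset.mul_sum, Finset.mul_sum]
    have hM1 : ∀ (n : ℕ) (δ : ℝ) (i : Fin n), 0 < n → 0 ≤ δ → δ ≤ 1 →
        ‖z n i‖ ≤ C2 * (δ ^ 2 + ∑ j, ℓ n δ j) := by
      intro n δ i hn hδ hδ1
      have h1 := hKB n δ i hn hδ
      have hF := hFeller n δ i hn
      have hli : ℓ n δ i ≤ ∑ j, ℓ n δ j :=
        Finset.single_le_sum (fun j _ => hℓ0 n δ j) (Finset.mem_univ i)
      have h2 : ‖((-(t ^ 2 * a n i / 2) : ℝ) : ℂ)‖ = t ^ 2 * a n i / 2 := by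
        rw [Complex.norm_real, Real.norm_eq_abs, abs_neg, abs_of_nonneg]
        have := ha0 n i; positivity
      have h3 : ‖z n i‖ ≤ |t| ^ 3 * δ * a n i + 3 / 2 * t ^ 2 * ℓ n δ i + t ^ 2 * a n i / 2 := by
        calc ‖z n i‖ ≤ ‖z n i - ((-(t ^ 2 * a n i / 2) : ℝ) : ℂ)‖ + ‖((-(t ^ 2 * a n i / 2) : ℝ) : ℂ)‖ :=
              norm_le_norm_sub_add _ _
          _ ≤ _ := by rw [h2]; exact add_le_add h1 le_rfl
      have ht3 : 0 ≤ |t| ^ 3 := by positivity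
      have ha' := ha0 n i
      have hl' := hℓ0 n δ i
      -- `|t|³δ a ≤ |t|³ a ≤ |t|³ (δ² + ℓ)` etc.
      have h4 : |t| ^ 3 * δ * a n i ≤ |t| ^ 3 * (δ ^ 2 + ℓ n δ i) := by
        calc |t| ^ 3 * δ * a n i ≤ |t| ^ 3 * 1 * a n i := by gcongr
          _ ≤ |t| ^ 3 * (δ ^ 2 + ℓ n δ i) := by rw [mul_one]; exact mul_le_mul_of_nonneg_left hF ht3
      have h5 : t ^ 2 * a n i / 2 ≤ t ^ 2 / 2 * (δ ^ 2 + ℓ n δ i) := by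
        have := mul_le_mul_of_nonneg_left hF (by positivity : 0 ≤ t ^ 2 / 2)
        linarith
      have hL0 : 0 ≤ ∑ j, ℓ n δ j := Finset.sum_nonneg fun j _ => hℓ0 n δ j
      have hδsq : 0 ≤ δ ^ 2 := sq_nonneg δ
      have ht2 : 0 ≤ t ^ 2 := sq_nonneg t
      -- coefficients against `C2 = |t|³ + 2t² + 1`
      have c1 : (|t| ^ 3 + t ^ 2 / 2) * δ ^ 2 ≤ C2 * δ ^ 2 :=
        mul_le_mul_of_nonneg_right (by simp only [hC2]; linarith) hδsq
      have c2 : (|t| ^ 3 + 2 * t ^ 2) * ℓ n δ i ≤ C2 * ∑ j, ℓ n δ j := by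
        calc (|t| ^ 3 + 2 * t ^ 2) * ℓ n δ i ≤ C2 * ℓ n δ i :=
              mul_le_mul_of_nonneg_right (by simp only [hC2]; linarith) hl'
          _ ≤ C2 * ∑ j, ℓ n δ j := mul_le_mul_of_nonneg_left hli hC2pos.le
      have e : |t| ^ 3 * (δ ^ 2 + ℓ n δ i) + 3 / 2 * t ^ 2 * ℓ n δ i + t ^ 2 / 2 * (δ ^ 2 + ℓ n δ i)
          = (|t| ^ 3 + t ^ 2 / 2) * δ ^ 2 + (|t| ^ 3 + 2 * t ^ 2) * ℓ n δ i := by ring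
      calc ‖z n i‖ ≤ |t| ^ 3 * δ * a n i + 3 / 2 * t ^ 2 * ℓ n δ i + t ^ 2 * a n i / 2 := h3
        _ ≤ |t| ^ 3 * (δ ^ 2 + ℓ n δ i) + 3 / 2 * t ^ 2 * ℓ n δ i + t ^ 2 / 2 * (δ ^ 2 + ℓ n δ i) := by
            linarith
        _ = (|t| ^ 3 + t ^ 2 / 2) * δ ^ 2 + (|t| ^ 3 + 2 * t ^ 2) * ℓ n δ i := e
        _ ≤ C2 * δ ^ 2 + C2 * ∑ j, ℓ n δ j := add_le_add c1 c2
        _ = C2 * (δ ^ 2 + ∑ j, ℓ n δ j) := by ring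
    have hM2 : ∀ (n : ℕ) (δ : ℝ), 0 < n → 0 ≤ δ → δ ≤ 1 →
        ∑ i, ‖z n i‖ ≤ C2 * (∑ i, a n i + ∑ i, ℓ n δ i) := by
      intro n δ hn hδ hδ1
      have h1 : ∑ i, ‖z n i‖ ≤ ∑ i, (|t| ^ 3 * δ * a n i + 3 / 2 * t ^ 2 * ℓ n δ i + t ^ 2 * a n i / 2) := by
        refine Finset.sum_le_sum fun i _ => ?_
        have h2 : ‖((-(t ^ 2 * a n i / 2) : ℝ) : ℂ)‖ = t ^ 2 * a n i / 2 := by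
          rw [Complex.norm_real, Real.norm_eq_abs, abs_neg, abs_of_nonneg]
          have := ha0 n i; positivity
        calc ‖z n i‖ ≤ ‖z n i - ((-(t ^ 2 * a n i / 2) : ℝ) : ℂ)‖ + ‖((-(t ^ 2 * a n i / 2) : ℝ) : ℂ)‖ :=
              norm_le_norm_sub_add _ _
          _ ≤ _ := by rw [h2]; exact add_le_add (hKB n δ i hn hδ) le_rfl
      have e : ∑ i, (|t| ^ 3 * δ * a n i + 3 / 2 * t ^ 2 * ℓ n δ i + t ^ 2 * a n i / 2)
          = |t| ^ 3 * δ * ∑ i, a n i + 3 / 2 * t ^ 2 * ∑ i, ℓ n δ i + t ^ 2 / 2 * ∑ i, a n i := by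
        rw [Finset.mul_sum, Finset.mul_sum, Finset.mul_sum, ← Finset.sum_add_distrib,
          ← Finset.sum_add_distrib]
        exact Finset.sum_congr rfl fun i _ => by ring
      rw [e] at h1
      have hs0 : 0 ≤ ∑ i, a n i := Finset.sum_nonneg fun i _ => ha0 n i
      have hL0 : 0 ≤ ∑ i, ℓ n δ i := Finset.sum_nonneg fun i _ => hℓ0 n δ i
      have ht3 : 0 ≤ |t| ^ 3 := by positivity
      have ht2 : 0 ≤ t ^ 2 := sq_nonneg t
      have c0 : |t| ^ 3 * δ * ∑ i, a n i ≤ |t| ^ 3 * ∑ i, a n i := by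
        calc |t| ^ 3 * δ * ∑ i, a n i ≤ |t| ^ 3 * 1 * ∑ i, a n i := by gcongr
          _ = |t| ^ 3 * ∑ i, a n i := by rw [mul_one]
      have c1 : (|t| ^ 3 + t ^ 2 / 2) * ∑ i, a n i ≤ C2 * ∑ i, a n i :=
        mul_le_mul_of_nonneg_right (by simp only [hC2]; linarith) hs0
      have c2 : 3 / 2 * t ^ 2 * ∑ i, ℓ n δ i ≤ C2 * ∑ i, ℓ n δ i :=
        mul_le_mul_of_nonneg_right (by simp only [hC2]; linarith) hL0
      calc ∑ i, ‖z n i‖ ≤ |t| ^ 3 * δ * ∑ i, a n i + 3 / 2 * t ^ 2 * ∑ i, ℓ n δ i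
            + t ^ 2 / 2 * ∑ i, a n i := h1
        _ ≤ (|t| ^ 3 + t ^ 2 / 2) * ∑ i, a n i + 3 / 2 * t ^ 2 * ∑ i, ℓ n δ i := by linarith
        _ ≤ C2 * ∑ i, a n i + C2 * ∑ i, ℓ n δ i := add_le_add c1 c2
        _ = C2 * (∑ i, a n i + ∑ i, ℓ n δ i) := by ring
    -- eventual bounds on `s` and `L`
    have hs_ev : ∀ᶠ n : ℕ in atTop, ∑ i, a n i ≤ σ2 + 1 := by
      have := (tendsto_order.1 hσ').2 (σ2 + 1) (by linarith)
      exact this.mono fun n hn => hn.le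
    have hL_ev : ∀ (δ η : ℝ), 0 < δ → 0 < η → ∀ᶠ n : ℕ in atTop, ∑ i, ℓ n δ i < η := fun δ η hδ hη =>
      (tendsto_order.1 (hL' δ hδ)).2 η hη
    -- (1) Σ z → −σ²t²/2
    have hsum : Tendsto (fun n => ∑ i, z n i) atTop (𝓝 ((-(σ2 * t ^ 2 / 2) : ℝ) : ℂ)) := by
      have hmain : Tendsto (fun n : ℕ => ((-(t ^ 2 / 2 * ∑ i, a n i) : ℝ) : ℂ)) atTop
          (𝓝 ((-(σ2 * t ^ 2 / 2) : ℝ) : ℂ)) := by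
        have h1 : Tendsto (fun n : ℕ => -(t ^ 2 / 2 * ∑ i, a n i)) atTop (𝓝 (-(σ2 * t ^ 2 / 2))) := by
          have := (hσ'.const_mul (t ^ 2 / 2)).neg; convert this using 2; ring
        exact (Complex.continuous_ofReal.tendsto _).comp h1
      have hrem : Tendsto (fun n : ℕ => ∑ i, z n i - ((-(t ^ 2 / 2 * ∑ i, a n i) : ℝ) : ℂ)) atTop (𝓝 0) := by
        rw [Metric.tendsto_atTop]
        intro η hη
        set C : ℝ := |t| ^ 3 * (σ2 + 1) + 1 with hC
        have hCpos : 0 < C := by positivity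
        set δ : ℝ := min 1 (η / (2 * C)) with hδ
        have hδ0 : 0 < δ := lt_min one_pos (by positivity)
        have hδC : |t| ^ 3 * δ * (σ2 + 1) ≤ η / 2 := by
          have h1 : δ ≤ η / (2 * C) := min_le_right _ _
          have h2 : |t| ^ 3 * (σ2 + 1) ≤ C := by simp only [hC]; linarith
          calc |t| ^ 3 * δ * (σ2 + 1) = δ * (|t| ^ 3 * (σ2 + 1)) := by ring
            _ ≤ (η / (2 * C)) * C := mul_le_mul h1 h2 (by positivity) (by positivity)
            _ = η / 2 := by field_simp
        have hev := (hs_ev.and ((hL_ev δ (η / (3 * t ^ 2 + 1)) hδ0 (by positivity)).and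
          (eventually_gt_atTop 0)))
        obtain ⟨N, hN⟩ := Filter.eventually_atTop.1 hev
        refine ⟨N, fun n hn => ?_⟩
        obtain ⟨hs, hLn, hn0⟩ := hN n hn
        rw [dist_zero_right]
        have hb := hM3 n δ hn0 hδ0.le
        have hs0 : 0 ≤ ∑ i, a n i := Finset.sum_nonneg fun i _ => ha0 n i
        have hL3 : 3 / 2 * t ^ 2 * (η / (3 * t ^ 2 + 1)) < η / 2 := by
          rw [← sub_pos]; field_simp; nlinarith [sq_nonneg t]
        have ht3 : 0 ≤ |t| ^ 3 := by positivity
        calc ‖∑ i, z n i - ((-(t ^ 2 / 2 * ∑ i, a n i) : ℝ) : ℂ)‖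
            ≤ |t| ^ 3 * δ * ∑ i, a n i + 3 / 2 * t ^ 2 * ∑ i, ℓ n δ i := hb
          _ ≤ |t| ^ 3 * δ * (σ2 + 1) + 3 / 2 * t ^ 2 * (η / (3 * t ^ 2 + 1)) := by
              refine add_le_add (mul_le_mul_of_nonneg_left hs (by positivity)) ?_
              exact mul_le_mul_of_nonneg_left hLn.le (by positivity)
          _ < η := by linarith
      have := hmain.add hrem
      simpa using this
    -- (2) Σ ‖z‖² → 0
    have hsq : Tendsto (fun n => ∑ i, ‖z n i‖ ^ 2) atTop (𝓝 0) := by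
      rw [Metric.tendsto_atTop]
      intro η hη
      set D : ℝ := C2 ^ 2 * (σ2 + 2) with hD
      have hDpos : 0 < D := by positivity
      set δ : ℝ := min 1 (η / (2 * D + 1)) with hδ
      have hδ0 : 0 < δ := lt_min one_pos (by positivity)
      have hδ1 : δ ≤ 1 := min_le_left _ _
      have hδ2 : D * δ ^ 2 < η / 2 := by
        have h1 : δ ^ 2 ≤ δ := by nlinarith
        have h2 : δ ≤ η / (2 * D + 1) := min_le_right _ _
        calc D * δ ^ 2 ≤ D * (η / (2 * D + 1)) := by
              exact mul_le_mul_of_nonneg_left (h1.trans h2) hDpos.le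
          _ < η / 2 := by rw [← sub_pos]; field_simp; nlinarith
      have hev := hs_ev.and (((hL_ev δ (min 1 (η / (2 * D + 1))) hδ0 (lt_min one_pos (by positivity)))).and
        (eventually_gt_atTop 0))
      obtain ⟨N, hN⟩ := Filter.eventually_atTop.1 hev
      refine ⟨N, fun n hn => ?_⟩
      obtain ⟨hs, hLn, hn0⟩ := hN n hn
      have hL1 : ∑ i, ℓ n δ i ≤ 1 := (hLn.le.trans (min_le_left _ _))
      have hL2 : ∑ i, ℓ n δ i ≤ η / (2 * D + 1) := hLn.le.trans (min_le_right _ _)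
      have hL0 : 0 ≤ ∑ i, ℓ n δ i := Finset.sum_nonneg fun i _ => hℓ0 n δ i
      have hs0 : 0 ≤ ∑ i, a n i := Finset.sum_nonneg fun i _ => ha0 n i
      rw [dist_zero_right, Real.norm_eq_abs, abs_of_nonneg (Finset.sum_nonneg fun i _ => sq_nonneg _)]
      -- Σ‖z‖² ≤ (max bound)·Σ‖z‖
      have hmax : ∀ i, ‖z n i‖ ≤ C2 * (δ ^ 2 + ∑ j, ℓ n δ j) := fun i => hM1 n δ i hn0 hδ0.le hδ1
      have hS := hM2 n δ hn0 hδ0.le hδ1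
      calc ∑ i, ‖z n i‖ ^ 2 ≤ ∑ i, C2 * (δ ^ 2 + ∑ j, ℓ n δ j) * ‖z n i‖ := by
            refine Finset.sum_le_sum fun i _ => ?_
            rw [sq]; exact mul_le_mul_of_nonneg_right (hmax i) (norm_nonneg _)
        _ = C2 * (δ ^ 2 + ∑ j, ℓ n δ j) * ∑ i, ‖z n i‖ := by rw [Finset.mul_sum]
        _ ≤ C2 * (δ ^ 2 + ∑ j, ℓ n δ j) * (C2 * (∑ i, a n i + ∑ i, ℓ n δ i)) :=
            mul_le_mul_of_nonneg_left hS (by positivity)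
        _ ≤ C2 * (δ ^ 2 + ∑ j, ℓ n δ j) * (C2 * (σ2 + 2)) := by
            refine mul_le_mul_of_nonneg_left (mul_le_mul_of_nonneg_left (by linarith) hC2pos.le)
              (by positivity)
        _ = D * δ ^ 2 + D * ∑ j, ℓ n δ j := by simp only [hD]; ring
        _ < η / 2 + η / 2 := by
            refine add_lt_add_of_lt_of_le hδ2 ?_
            calc D * ∑ j, ℓ n δ j ≤ D * (η / (2 * D + 1)) := mul_le_mul_of_nonneg_left hL2 hDpos.le
              _ ≤ η / 2 := by rw [← sub_nonneg]; field_simp; nlinarith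
        _ = η := by ring
    -- (3) uniform smallness
    have hsmall : ∀ᶠ n in atTop, ∀ i : Fin n, ‖z n i‖ ≤ 1 / 2 := by
      set δ : ℝ := min 1 (1 / (4 * C2)) with hδ
      have hδ0 : 0 < δ := lt_min one_pos (by positivity)
      have hδ1 : δ ≤ 1 := min_le_left _ _
      have hδ2 : C2 * δ ^ 2 ≤ 1 / 4 := by
        have h1 : δ ^ 2 ≤ δ := by nlinarith
        have h2 : δ ≤ 1 / (4 * C2) := min_le_right _ _
        calc C2 * δ ^ 2 ≤ C2 * (1 / (4 * C2)) := mul_le_mul_of_nonneg_left (h1.trans h2) hC2pos.le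
          _ = 1 / 4 := by field_simp
      filter_upwards [hL_ev δ (1 / (4 * C2)) hδ0 (by positivity), eventually_gt_atTop 0] with n hLn hn0 i
      have h1 := hM1 n δ i hn0 hδ0.le hδ1
      have h2 : C2 * ∑ j, ℓ n δ j ≤ 1 / 4 := by
        calc C2 * ∑ j, ℓ n δ j ≤ C2 * (1 / (4 * C2)) := mul_le_mul_of_nonneg_left hLn.le hC2pos.le
          _ = 1 / 4 := by field_simp
      calc ‖z n i‖ ≤ C2 * (δ ^ 2 + ∑ j, ℓ n δ j) := h1
        _ = C2 * δ ^ 2 + C2 * ∑ j, ℓ n δ j := by ring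
        _ ≤ 1 / 4 + 1 / 4 := add_le_add hδ2 h2
        _ = 1 / 2 := by norm_num
    have key := tendsto_finprod_one_add_cexp hsum hsq hsmall
    have e : ∀ n : ℕ, ∏ i, (1 + z n i) = ∏ i, charFun ((ρ n i).map (h n i)) ((Real.sqrt n)⁻¹ * t) :=
      fun n => Finset.prod_congr rfl fun i _ => by simp [hz]
    simp_rw [e] at key
    convert key using 2
    push_cast
    ring

end Lindeberg

end Summit.Ventures.LatticeQCDFlow.Theory2

end
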